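import Summits.Ventures.YMGap.YM3IR.BalabanSUN
import Summits.Ventures.YMGap.RobustBall.StarRowsSU3PV2Dim3
import HarnessLib

/-!
# YM3IR / BalabanCeilingsSU3PV2 — the §Y4 sentence for `SU(3)` on engine-2's HYPOTHESIS-FREE PV2-star rows (Wilson `β_W = 13/25`,
`1/2` and `12/25`), with the counted crossover (theorems only; no new conjecture name)

HONEST FRAMING (cell pub-ymgap, track Y4 / YM3-IR, seat ym3ir-theory-1, gen 13; follow-up to `YM3IR/BalabanCeilingsSU3PV.lean`, written
once engine-2 (g10)'s `RobustBall/StarRowsSU3PV2Dim3.lean` (the `d = 3` cells of `StarRowsSU3PV2`, ds-2's robust vertex-star doors on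
engine-2's hypothesis-free CENTRED Poincaré × Schwinger–Dyson modulus `OneLinkVarianceSDC.oneLinkKRModulus_pv2_of_le`) is in the tree WITH
COMMIT, per R212 (iii)).  This file claims NO summit, NO mass gap and NO part of Bałaban's theorems.
It is kernel-checked BOOKKEEPING: `BalabanSUN.massGap3Cofinal_suN_balaban_of_irConjecture3` at `N = 3` with track Y2's input
(`ClusterDomainClustering`) DISCHARGED BY NAME by engine-2's hypothesis-free `SU(3)` PV2-star rows:
`RobustBall.su3_clusterDomainClustering_dim3_pv2Star_thirteenTwentyFifths r` (tree ceiling `13/75` = Wilson `13/25`, ball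
`ClusterDomainFR (3/125) (3/250) r` — the highest hypothesis-free `SU(3)` `d = 3` ceiling in the tree), the working row
`…_oneHalf r` (tree `1/6` = Wilson `1/2`, ball `ClusterDomainFR (3/50) (3/100) r`) and the FAT row `…_twelveTwentyFifths r` (tree `4/25` =
Wilson `12/25`, ball `ClusterDomainFR (47/500) (47/1000) r` ⊋ the PV-star ball `(3/500, 3/1000)` of `BalabanCeilingsSU3PV` at the same
ceiling — a WEAKER hypothesis (a) by `YM3IR/BallMonotone.lean`).  WHAT MOVES on the UV side: the hypothesis-free `SU(3)` tier-1 receiving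
end of the §Y4 sentence rises from Wilson `12/25` (`BalabanCeilingsSU3PV`) to `13/25`; the CERTIFIED rows GIVEN H1, H2
(`BalabanCeilingsSU3Certified`, Wilson `33/40`) are untouched and remain higher.  Lattice statements only; strong-coupling constants; no
continuum limit, no Millennium claim; no axiom, no `sorry`, no `def`; `0` compute.

THE HYPOTHESIS LIST, VERBATIM (`massGap3Cofinal_su3_balaban_pv2Star_thirteenTwentyFifths_of_irConjecture3`): `BalabanUV3 mk` — IN PRINT
(Bałaban, CMP 102 (1985), Thm 1 p. 257 + Thm 2 p. 272), EVIDENTIAL (theory-2 F2: the kernel arrow does not consume it);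
`Nonempty (Family L eps0)` — print's clauses at one coupling (p. 256 L15–18); `0 < C_b`, `0 < κ`;
`IRConjecture3 (ballOfRobustBallFR 3 (3/125) (3/250) r (13/75)) suFrobDist (fundamentalRep (Fin 3)) (balabanCouplings L (suGroupModel 3)
eps0) C_b κ` — the ONE CONJECTURE of record (theory-2, `YM3IR/Statement.lean`; NOT in print).  LABEL OF RECORD (R196, verbatim): with
existential `(C_b, κ)` this is a typed INTERFACE, a «dictionary, not a reduction» (forest witness, `YM3IR/ForestWitnessSUN.lean`).
CONCLUSION: `MassGap3Cofinal (balabanCouplings L (suGroupModel 3) eps0) suFrobDist (fundamentalRep (Fin 3))`.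

COUNTED CROSSOVER (PROVED arithmetic, tree units `β = β_W/3`): below the ceiling `13/75` after `K + M'` steps iff `L^{M'} ≥ 25/(13γ₀²)`
(`su3_betaTree_div_pow_le_13_75_iff`; `≥ 25/13` with `γ₀² ≤ 1`), vs `25/(12γ₀²)` at `4/25` (`BalabanCeilingsSU3PV.su3_betaTree_div_pow_le_4_25_iff`)
and `2/γ₀²` at the working row `1/6` (`su3_betaTree_div_pow_le_sixth_iff`).

WHY THIS IS NOVEL (one sentence).  The `SU(3)` — physical colour group — instance of «print + certified strong-coupling expansion + ONE
named conjecture ⟹ lattice YM₃ mass gap on Bałaban's coupling set» with Y2's input a HYPOTHESIS-FREE theorem up to Wilson `β_W = 13/25`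
and its explicit crossover count `L^{M'} ≥ 25/(13γ₀²)`.

References: T. Bałaban, CMP 102 (1985) 255–275, p. 256 L15–18, (5) p. 256, Thm 1 p. 257, Thm 2 p. 272 [cite: Balaban1985UV3];
H. Shen, R. Zhu, X. Zhu, CMP 400 (2023) (the vertex σ-model dictionary behind the star rows; engine-2's file header).
-/

noncomputable section

open MeasureTheory
open Literature.MathematicalPhysics.QuantumLattice Literature.MathematicalPhysics.QuantumFieldTheory
open Balaban1985CMP102 Balaban1985CMP102.Setting Balaban1985CMP102.Theorems
open Literature.MathematicalPhysics.QuantumFieldTheory.Balaban1983to89 (GaugeGroup HaarData)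
open Summit.QuantumFields.Balaban3D.Carriers (suGroupModel)

namespace Summit.Ventures.YMGap.YM3IR

open CarrierBridge

/-- **`SU(3)` lattice YM₃ mass gap on Bałaban's coupling set, receiving at Wilson `β_W = 13/25`, Y2's input HYPOTHESIS-FREE (PROVED
bookkeeping).**  engine-2's PV2-star row `RobustBall.su3_clusterDomainClustering_dim3_pv2Star_thirteenTwentyFifths r` BY NAME (tree ceiling
`13/75`, ball `ClusterDomainFR (3/125) (3/250) r`, some rate `m > 0`).  EXACTLY ONE hypothesis is neither in print nor certified:
`IRConjecture3` (label of record R196: with existential `(C_b, κ)` a typed interface — a dictionary, not a reduction).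
[cite: Balaban1985UV3, Thm 1 p.257; Thm 2 p.272] -/
theorem massGap3Cofinal_su3_balaban_pv2Star_thirteenTwentyFifths_of_irConjecture3 {L : ℕ} {mk : Construction L} {eps0 : ℝ → ℝ}
    (hfam : Nonempty (Family L eps0)) (r : ℕ) {C_b κ : ℝ} (hC : 0 < C_b) (hκ : 0 < κ) (hUV : BalabanUV3 mk)
    (hIR : IRConjecture3 (ballOfRobustBallFR 3 (3 / 125) (3 / 250) r (13 / 75)) suFrobDist (fundamentalRep (Fin 3))
      (balabanCouplings L (suGroupModel 3) eps0) C_b κ) :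
    MassGap3Cofinal (balabanCouplings L (suGroupModel 3) eps0) suFrobDist
      (fundamentalRep (Fin 3) : RobustBall.SUN 3 →* Matrix (Fin 3) (Fin 3) ℂ) := by
  obtain ⟨m, hm, hRB, -⟩ := RobustBall.su3_clusterDomainClustering_dim3_pv2Star_thirteenTwentyFifths r
  exact massGap3Cofinal_suN_balaban_of_irConjecture3 hfam hC hκ hm hUV hRB hIR

/-- **The same at Wilson `β_W = 1/2` (tree ceiling `1/6`), Y2's input HYPOTHESIS-FREE on the larger working ball (PROVED bookkeeping):**
engine-2's `RobustBall.su3_clusterDomainClustering_dim3_pv2Star_oneHalf r` (ball `ClusterDomainFR (3/50) (3/100) r`); the ONE non-printed,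
non-certified hypothesis is `IRConjecture3` (label of record R196: with existential `(C_b, κ)` a dictionary, not a reduction).
[cite: Balaban1985UV3, Thm 1 p.257; Thm 2 p.272] -/
theorem massGap3Cofinal_su3_balaban_pv2Star_oneHalf_of_irConjecture3 {L : ℕ} {mk : Construction L} {eps0 : ℝ → ℝ}
    (hfam : Nonempty (Family L eps0)) (r : ℕ) {C_b κ : ℝ} (hC : 0 < C_b) (hκ : 0 < κ) (hUV : BalabanUV3 mk)
    (hIR : IRConjecture3 (ballOfRobustBallFR 3 (3 / 50) (3 / 100) r (1 / 6)) suFrobDist (fundamentalRep (Fin 3))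
      (balabanCouplings L (suGroupModel 3) eps0) C_b κ) :
    MassGap3Cofinal (balabanCouplings L (suGroupModel 3) eps0) suFrobDist
      (fundamentalRep (Fin 3) : RobustBall.SUN 3 →* Matrix (Fin 3) (Fin 3) ℂ) := by
  obtain ⟨m, hm, hRB, -⟩ := RobustBall.su3_clusterDomainClustering_dim3_pv2Star_oneHalf r
  exact massGap3Cofinal_suN_balaban_of_irConjecture3 hfam hC hκ hm hUV hRB hIR

/-- **The same at Wilson `β_W = 12/25` (tree ceiling `4/25`) on the FAT PV2 ball `ClusterDomainFR (47/500) (47/1000) r`** — a strictly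
larger receiving ball than `BalabanCeilingsSU3PV`'s `(3/500, 3/1000)` at the same ceiling, hence a WEAKER hypothesis (a)
(`YM3IR/BallMonotone.lean`); engine-2's `RobustBall.su3_clusterDomainClustering_dim3_pv2Star_twelveTwentyFifths r` BY NAME (PROVED
bookkeeping; label of record R196: `IRConjecture3` with existential `(C_b, κ)` is a dictionary, not a reduction).
[cite: Balaban1985UV3, Thm 1 p.257; Thm 2 p.272] -/
theorem massGap3Cofinal_su3_balaban_pv2Star_twelveTwentyFifths_of_irConjecture3 {L : ℕ} {mk : Construction L} {eps0 : ℝ → ℝ}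
    (hfam : Nonempty (Family L eps0)) (r : ℕ) {C_b κ : ℝ} (hC : 0 < C_b) (hκ : 0 < κ) (hUV : BalabanUV3 mk)
    (hIR : IRConjecture3 (ballOfRobustBallFR 3 (47 / 500) (47 / 1000) r (4 / 25)) suFrobDist (fundamentalRep (Fin 3))
      (balabanCouplings L (suGroupModel 3) eps0) C_b κ) :
    MassGap3Cofinal (balabanCouplings L (suGroupModel 3) eps0) suFrobDist
      (fundamentalRep (Fin 3) : RobustBall.SUN 3 →* Matrix (Fin 3) (Fin 3) ℂ) := by
  obtain ⟨m, hm, hRB, -⟩ := RobustBall.su3_clusterDomainClustering_dim3_pv2Star_twelveTwentyFifths r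
  exact massGap3Cofinal_suN_balaban_of_irConjecture3 hfam hC hκ hm hUV hRB hIR

/-- **In PRINT'S quantifier order at `β_W = 13/25` (PROVED bookkeeping):** `∃ eps0` first (print, p. 256 L15–18), then for every `r`,
`C_b`, `κ`: `IRConjecture3` on the row's ball (label of record R196: a dictionary, not a reduction) ⟹ `MassGap3Cofinal`.
[cite: Balaban1985UV3, p.256 L15–18; Thm 2 p.272] -/
theorem massGap3Cofinal_su3_balaban_pv2Star_thirteenTwentyFifths_printedOrder_of_irConjecture3 {L : ℕ} (mk : Construction L)
    (hUV : BalabanUV3 mk) :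
    ∃ eps0 : ℝ → ℝ, (∀ g : ℝ, 0 < g → 0 < eps0 g) ∧
      (∀ S : Family L eps0, ∀ k, k ≤ S.1.K → (mk (RobustBall.SUN 3) (suGroupModel 3) S.1).ineq41_47 k) ∧
      ∀ (r : ℕ) (C_b κ : ℝ), 0 < C_b → 0 < κ → Nonempty (Family L eps0) →
        IRConjecture3 (ballOfRobustBallFR 3 (3 / 125) (3 / 250) r (13 / 75)) suFrobDist (fundamentalRep (Fin 3))
          (balabanCouplings L (suGroupModel 3) eps0) C_b κ →
          MassGap3Cofinal (balabanCouplings L (suGroupModel 3) eps0) suFrobDist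
            (fundamentalRep (Fin 3) : RobustBall.SUN 3 →* Matrix (Fin 3) (Fin 3) ℂ) := by
  obtain ⟨eps0, hpos, h2, h⟩ := massGap3Cofinal_suN_balaban_printedOrder_of_irConjecture3 (N := 3) mk hUV
  refine ⟨eps0, hpos, h2, fun r C_b κ hC hκ hfam hIR => ?_⟩
  obtain ⟨m, hm, hRB, -⟩ := RobustBall.su3_clusterDomainClustering_dim3_pv2Star_thirteenTwentyFifths r
  exact h (ballOfRobustBallFR 3 (3 / 125) (3 / 250) r (13 / 75)) C_b κ m hC hκ hm hfam hRB hIR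

/-- **`SU(3)` at the hypothesis-free ceiling `β⋆ = 13/75` (`β_W = 13/25`; PROVED arithmetic):** a member's coupling after `K + M'` steps is
below `13/75` iff `L^{M'} ≥ 25/(13γ₀²)`. [cite: Balaban1985UV3, (5) p.256] -/
theorem su3_betaTree_div_pow_le_13_75_iff {L : ℕ} (S : Scales L) (M' : ℕ) :
    betaTree (suGroupModel 3) S / (L : ℝ) ^ (S.K + M') ≤ 13 / 75 ↔ 25 / (13 * Dictionary.gammaSq S) ≤ (L : ℝ) ^ M' := by
  rw [suN_betaTree_div_pow_le_iff S M' (by norm_num : (0 : ℝ) < 13 / 75)]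
  have e : (((3 : ℕ) : ℝ) * Dictionary.gammaSq S * (13 / 75))⁻¹ = 25 / (13 * Dictionary.gammaSq S) := by
    have e1 : ((3 : ℕ) : ℝ) * Dictionary.gammaSq S * (13 / 75) = 13 * Dictionary.gammaSq S / 25 := by
      push_cast
      ring
    rw [e1, inv_div]
  rw [e]

/-- Hence at `β⋆ = 13/75` for `SU(3)` (PROVED arithmetic; `γ₀² ≤ 1`): in the window after `K + M'` steps forces `25/13 ≤ L^{M'}`.
[cite: Balaban1985UV3, (5) p.256] -/
theorem su3_twentyFiveThirteenths_le_pow_of_betaTree_div_pow_le_13_75 {L : ℕ} (S : Scales L) (M' : ℕ)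
    (h : betaTree (suGroupModel 3) S / (L : ℝ) ^ (S.K + M') ≤ 13 / 75) : (25 / 13 : ℝ) ≤ (L : ℝ) ^ M' := by
  have hγ : 0 < Dictionary.gammaSq S := Dictionary.gammaSq_pos S
  have hγ1 : Dictionary.gammaSq S ≤ 1 := Dictionary.gammaSq_le_one S
  have h3 : 25 / (13 * Dictionary.gammaSq S) ≤ (L : ℝ) ^ M' := (su3_betaTree_div_pow_le_13_75_iff S M').1 h
  have h33 : (25 / 13 : ℝ) ≤ 25 / (13 * Dictionary.gammaSq S) := by
    rw [le_div_iff₀ (by positivity)]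
    nlinarith
  exact h33.trans h3

/-- **The conjecture's counted task on the `SU(3)` `β_W = 13/25` row (PROVED arithmetic), at the row's ball for the record.**
[cite: Balaban1985UV3, (5) p.256] -/
theorem su3_row_pv2Star_thirteenTwentyFifths_crossover_steps {L : ℕ} (S : Scales L) (M' : ℕ)
    (h : betaTree (suGroupModel 3) S / (L : ℝ) ^ (S.K + M') ≤
      (ballOfRobustBallFR 3 (3 / 125) (3 / 250) 0 (13 / 75)).βstar) :
    (25 / 13 : ℝ) ≤ (L : ℝ) ^ M' :=
  su3_twentyFiveThirteenths_le_pow_of_betaTree_div_pow_le_13_75 S M' h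

/-- **`SU(3)` at the working row `β⋆ = 1/6` (`β_W = 1/2`; PROVED arithmetic):** below `1/6` after `K + M'` steps iff `L^{M'} ≥ 2/γ₀²`.
[cite: Balaban1985UV3, (5) p.256] -/
theorem su3_betaTree_div_pow_le_sixth_iff {L : ℕ} (S : Scales L) (M' : ℕ) :
    betaTree (suGroupModel 3) S / (L : ℝ) ^ (S.K + M') ≤ 1 / 6 ↔ 2 / Dictionary.gammaSq S ≤ (L : ℝ) ^ M' := by
  rw [suN_betaTree_div_pow_le_iff S M' (by norm_num : (0 : ℝ) < 1 / 6)]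
  have e : (((3 : ℕ) : ℝ) * Dictionary.gammaSq S * (1 / 6))⁻¹ = 2 / Dictionary.gammaSq S := by
    have e1 : ((3 : ℕ) : ℝ) * Dictionary.gammaSq S * (1 / 6) = Dictionary.gammaSq S / 2 := by
      push_cast
      ring
    rw [e1, inv_div]
  rw [e]

end Summit.Ventures.YMGap.YM3IR

end
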